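import Literature.NumberTheory.Automorphic.UnitaryCurveCohCotangentForms
import Literature.NumberTheory.Automorphic.UnitaryGroupArchSection
import HarnessLib

/-!
# A cone frame of a rank-2 hermitian matrix at a complex place, from a rational diagonalisation and a Sylvester frame

Topic `NumberTheory/Automorphic`; namespace `Literature.NumberTheory.Automorphic.UnitaryCurveForms` (the CONE carriers of ★
`UnitaryCurveCohCotangentForms`, p793416).  ONE THEOREM, no definition, no named fact, no instance, no `sorry`.

For a CM field `L`, an embedding `ι : L → ℂ`, a matrix `J⋆ ∈ M₂(L)`, a scalar `t` with `ι t` real and positive, a rational frame `g⋆`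
with `ᵗ(c g⋆) (t • J⋆) g⋆ = diag dJ` and a complex Sylvester frame `T⋆` with `T⋆ᴴ (diag dJ)^{ι} T⋆ = diag(1, −1)` — exactly the
signature binders `hg`, `_hτt`, `_hτt'`, `_hsig.1` of the HLiu418 letters `S1Shape` ∕ `S1BettiShape` ∕ `S1bShape` — the hermitian matrix
`σ(J⋆)` at Mathlib's embedding `σ = (mk ι).embedding ∈ {ι, conj ∘ ι}` of the place of `ι` admits a CONE FRAME (★ `UnitaryCurveForms.ConeFrame`:
a negative vector `v₀` and a positive vector `t₀`, `σ(J⋆)`-orthogonal): the columns `M e₁`, `M e₀` of `M := g⋆^{ι} T⋆` satisfy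
`Mᴴ J⋆^{ι} M = (ι t)⁻¹ diag(1, −1)`, and the twist `embTwist ι` (★ `UnitaryGroupArchSection`: the identity or entrywise conjugation)
carries them to `σ`.  [BergeronMillsonMoeglin2016Balls, Part 2 §1.3] (negative cone and frames of a hermitian space of signature
`(n,1)`); the statement itself is linear algebra (Sylvester).  Consumers: the floor-0 sub-sub-lines `F0_AlbCmS1Betti` (F0P5-p01) and
`F0_AlbCmS1bHodge` (F0P5-p04) of crux HLiu418, which apply their `∀ 𝔣`-letters at this «frame of record».  HC_CM is proved only modulo
the 7 printed citations until rung 0 closes; nothing printed is asserted here.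

## References
* [BergeronMillsonMoeglin2016Balls] N. Bergeron, J. Millson, C. Moeglin, *The Hodge conjecture and arithmetic quotients of complex
  balls*, Acta Math. 216 (2016), Part 2 §1.3.
* [Liu2021] Y. Liu, *Fourier–Jacobi cycles and arithmetic relative trace formula*, Camb. J. Math. 9 (2021), App. D l. 5355 (the
  signature `(1,1)` at `τ₁`, `(2,0)` elsewhere of the rank-2 space).
-/

set_option autoImplicit false

noncomputable section

open NumberField NumberField.InfinitePlace Matrix
open scoped Matrix MatrixGroups ComplexConjugate ComplexOrder

namespace Literature.NumberTheory.Automorphic.UnitaryCurveForms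

open _root_.Literature.NumberTheory.Automorphic.UnitaryGroup _root_.Literature.AlgebraicGeometry.ShimuraVarieties

variable (L : Type) [Field L] [NumberField L] [IsCMField L] (ι₁ : L →+* ℂ)

/-- **A CONE FRAME EXISTS at the place of `ι₁`** for a rank-2 matrix `J⋆` over the CM field `L`, from a rational frame `g⋆` with
`ᵗ(c g⋆) (t • J⋆) g⋆ = diag dJ` (`hg`), `0 < ι₁ t` real (`hτt`, `hτt'`), and a complex Sylvester frame `T⋆` with
`T⋆ᴴ (diag dJ)^{ι₁} T⋆ = diag(1, −1)` (`hsig`).  The frame is `(e(M e₁), e(M e₀))` for `M := g⋆^{ι₁} T⋆` and the twist `e := embTwist ι₁`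
(identity or entrywise conjugation, matching Mathlib's embedding of the place `mk ι₁`): `v₀ᴴ J⋆^{σ} v₀ = −(ι₁ t)⁻¹ < 0`, `t₀ᴴ J⋆^{σ} t₀ = (ι₁ t)⁻¹ > 0`,
`t₀ᴴ J⋆^{σ} v₀ = 0`. [cite: BergeronMillsonMoeglin2016Balls, Part 2 §1.3] -/
theorem nonempty_coneFrame_of_sig (Jstar : Matrix (Fin 2) (Fin 2) L) (t : L) (hτt : 0 < (ι₁ t).re)
    (hτt' : (ι₁ t).im = 0) (gstar : GL (Fin 2) L) (dJ : Fin 2 → L)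
    (hg : formCongr ((IsCMField.complexConj L : L ≃ₐ[↥(maximalRealSubfield L)] L) :
        L →+* L) gstar (t • Jstar) = Matrix.diagonal dJ)
    (hsig : ∃ Tstar : GL (Fin 2) ℂ, formCongr (starRingEnd ℂ) Tstar ((Matrix.diagonal dJ).map ι₁) = Matrix.diagonal ![(1 : ℂ), -1]) :
    Nonempty (ConeFrame L Jstar (cmPlace L ι₁)) := by
  classical
  obtain ⟨Tstar, hT⟩ := hsig
  -- `tc := ι₁ t` is a non-zero (positive real) complex number
  have htc_ne : ι₁ t ≠ 0 := fun h => by rw [h] at hτt; simp at hτt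
  have htc_re : ((ι₁ t)⁻¹).re = (ι₁ t).re⁻¹ := by
    have h : ι₁ t = ((ι₁ t).re : ℂ) := Complex.ext rfl (by simpa using hτt')
    rw [h, ← Complex.ofReal_inv, Complex.ofReal_re, Complex.ofReal_re]
  have hpos : 0 < ((ι₁ t)⁻¹).re := by rw [htc_re]; exact inv_pos.mpr hτt
  -- (a) `hg` read over `ℂ` along `ι₁` (entrywise, `ι₁ ∘ c = conj ∘ ι₁`): `ι₁ t • (Gᴴ J₁ G) = (diag dJ)^{ι₁}`
  have hGform : ι₁ t • (((gstar : Matrix (Fin 2) (Fin 2) L).map ι₁)ᴴ * Jstar.map ι₁ *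
      (gstar : Matrix (Fin 2) (Fin 2) L).map ι₁) = (Matrix.diagonal dJ).map ι₁ := by
    ext i j
    have hij := congrArg (fun A : Matrix (Fin 2) (Fin 2) L => ι₁ (A i j)) hg
    simp only [formCongr, Matrix.mul_apply, Fin.sum_univ_two, Matrix.transpose_apply, Matrix.map_apply, Matrix.smul_apply,
      smul_eq_mul, map_mul, map_add, RingHom.coe_coe, IsCMField.complexEmbedding_complexConj] at hij
    simp only [Matrix.smul_apply, Matrix.mul_apply, Fin.sum_univ_two, Matrix.conjTranspose_apply, Matrix.map_apply,
      smul_eq_mul, RCLike.star_def]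
    linear_combination hij
  have hGform' : ((gstar : Matrix (Fin 2) (Fin 2) L).map ι₁)ᴴ * Jstar.map ι₁ *
      (gstar : Matrix (Fin 2) (Fin 2) L).map ι₁ = (ι₁ t)⁻¹ • (Matrix.diagonal dJ).map ι₁ := by
    rw [← hGform, smul_smul, inv_mul_cancel₀ htc_ne, one_smul]
  -- (b) `Tᴴ (diag dJ)^{ι₁} T = diag(1,-1)`
  have hconj : ∀ N : Matrix (Fin 2) (Fin 2) ℂ, (N.map (starRingEnd ℂ))ᵀ = Nᴴ := fun N => by
    ext i j
    simp [Matrix.conjTranspose_apply]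
  have hTform : (Tstar : Matrix (Fin 2) (Fin 2) ℂ)ᴴ * (Matrix.diagonal dJ).map ι₁ * (Tstar : Matrix (Fin 2) (Fin 2) ℂ) =
      Matrix.diagonal ![(1 : ℂ), -1] := by
    rw [← hconj]; exact hT
  -- (c) the frame matrix `M := G T` has `Mᴴ J₁ M = (ι₁ t)⁻¹ • diag(1,-1)`
  have hMform : ((gstar : Matrix (Fin 2) (Fin 2) L).map ι₁ * (Tstar : Matrix (Fin 2) (Fin 2) ℂ))ᴴ * Jstar.map ι₁ *
      ((gstar : Matrix (Fin 2) (Fin 2) L).map ι₁ * (Tstar : Matrix (Fin 2) (Fin 2) ℂ)) =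
      (ι₁ t)⁻¹ • Matrix.diagonal ![(1 : ℂ), -1] := by
    rw [← hTform, ← Matrix.smul_mul, ← Matrix.mul_smul, ← hGform', Matrix.conjTranspose_mul]
    simp only [Matrix.mul_assoc]
  -- (d) the form values on the columns of `M`
  have hform : ∀ (N : Matrix (Fin 2) (Fin 2) ℂ) (a b : Fin 2),
      star (fun i => N i a) ⬝ᵥ (Jstar.map ι₁ *ᵥ fun i => N i b) = (Nᴴ * Jstar.map ι₁ * N) a b := by
    intro N a b
    simp only [Matrix.mul_apply, Matrix.conjTranspose_apply, dotProduct, Matrix.mulVec, Pi.star_apply, Fin.sum_univ_two]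
    ring
  have h11 := hform ((gstar : Matrix (Fin 2) (Fin 2) L).map ι₁ * (Tstar : Matrix (Fin 2) (Fin 2) ℂ)) 1 1
  have h00 := hform ((gstar : Matrix (Fin 2) (Fin 2) L).map ι₁ * (Tstar : Matrix (Fin 2) (Fin 2) ℂ)) 0 0
  have h01 := hform ((gstar : Matrix (Fin 2) (Fin 2) L).map ι₁ * (Tstar : Matrix (Fin 2) (Fin 2) ℂ)) 0 1
  rw [hMform] at h11 h00 h01
  simp only [Matrix.smul_apply, Matrix.diagonal_apply_eq, smul_eq_mul] at h11 h00
  rw [Matrix.smul_apply, Matrix.diagonal_apply_ne _ (by decide : (0 : Fin 2) ≠ 1), smul_zero] at h01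
  have h11' : star (fun i => ((gstar : Matrix (Fin 2) (Fin 2) L).map ι₁ * (Tstar : Matrix (Fin 2) (Fin 2) ℂ)) i 1) ⬝ᵥ
      (Jstar.map ι₁ *ᵥ fun i => ((gstar : Matrix (Fin 2) (Fin 2) L).map ι₁ * (Tstar : Matrix (Fin 2) (Fin 2) ℂ)) i 1) =
      -(ι₁ t)⁻¹ := by
    rw [h11]; simp
  have h00' : star (fun i => ((gstar : Matrix (Fin 2) (Fin 2) L).map ι₁ * (Tstar : Matrix (Fin 2) (Fin 2) ℂ)) i 0) ⬝ᵥ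
      (Jstar.map ι₁ *ᵥ fun i => ((gstar : Matrix (Fin 2) (Fin 2) L).map ι₁ * (Tstar : Matrix (Fin 2) (Fin 2) ℂ)) i 0) =
      (ι₁ t)⁻¹ := by
    rw [h00]; simp
  -- (e) transport through the twist `e := embTwist ι₁` to Mathlib's embedding of the place `mk ι₁`
  have hJσ : Jstar.map (cmPlace L ι₁).1.embedding = (Jstar.map ι₁).map (embTwist L ι₁) :=
    (map_map_embTwist L 2 Jstar ι₁ (isComplex_mk_of_isCMField L ι₁)).symm
  have he_star : ∀ z : ℂ, embTwist L ι₁ (star z) = star (embTwist L ι₁ z) := fun z => embTwist_conj L ι₁ z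
  have htwist : ∀ u v : Fin 2 → ℂ,
      star (fun i => embTwist L ι₁ (u i)) ⬝ᵥ ((Jstar.map ι₁).map (embTwist L ι₁) *ᵥ fun i => embTwist L ι₁ (v i)) =
        embTwist L ι₁ (star u ⬝ᵥ (Jstar.map ι₁ *ᵥ v)) := by
    intro u v
    simp only [dotProduct, Matrix.mulVec, Pi.star_apply, Matrix.map_apply, map_sum, map_mul, he_star]
  have he_re : ∀ z : ℂ, (embTwist L ι₁ z).re = z.re := by
    intro z
    by_cases h : (InfinitePlace.mk ι₁).embedding = ι₁
    · rw [embTwist_apply_of_eq L ι₁ h]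
    · rw [embTwist_apply_of_ne L ι₁ h, Complex.conj_re]
  refine ⟨{ v₀ := fun i => embTwist L ι₁ (((gstar : Matrix (Fin 2) (Fin 2) L).map ι₁ * (Tstar : Matrix (Fin 2) (Fin 2) ℂ)) i 1)
            t₀ := fun i => embTwist L ι₁ (((gstar : Matrix (Fin 2) (Fin 2) L).map ι₁ * (Tstar : Matrix (Fin 2) (Fin 2) ℂ)) i 0)
            v₀_mem := ?_, t₀_pos := ?_, orth := ?_ }⟩
  · rw [mem_negCone_iff, hJσ, htwist, he_re, h11', Complex.neg_re, neg_lt_zero]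
    exact hpos
  · rw [hJσ, htwist, he_re, h00']
    exact hpos
  · rw [hJσ, htwist, h01, map_zero]


end Literature.NumberTheory.Automorphic.UnitaryCurveForms

end
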